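import Mathlib
import Summits.ValiantsHypothesis.ValiantsHypothesis.Theorems.LacunarySymmetroidMatrixDescartesInertiaKit
import Summits.ValiantsHypothesis.ValiantsHypothesis.Theorems.LacunarySymmetroidMatrixDescartesInertiaEndInertias

/-!
# `MatrixDescartes` (stmt-ValiantsHypothesis-18050) — Gram duality, part 14: HAYNSWORTH INERTIA ADDITIVITY
# `ν([[A, B],[Bᵀ, D]]) = ν(A) + ν(D − BᵀA⁻¹B)` (and `π`) in the inertia kit's currency

HONEST FRAMING.  Cell `pub-symmetroid`, seat `val-sym-mdr-p2` (gen 19); helper file `--supports` the crux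
`Theses.LacunarySymmetroid.MatrixDescartes` (OPEN), NO closure claim.  General real linear algebra (any finite index
types) feeding the INERTIA DUALITY of the Gram-duality files (companion `…GramDualInertiaDuality`: the negative-index
walk of a word equals the positive-index walk of its dual up to a constant).  Currency of `…InertiaKit`
(`ν(A) = card {j // hA.eigenvalues j < 0}`, `π(A) = card {j // 0 < hA.eigenvalues j}`).  Nothing here bears on the crux
in its window, `stub_twoSided`, `DoorA26` / `DoorA34`, registers, or `VP ≠ VNP`.

* `form_fromBlocks` — the real Schur-complement identity for the quadratic form of `M = [[A, B],[Bᵀ, D]]`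
  (`A` symmetric non-degenerate): `vᵀMv = (x + A⁻¹By)ᵀ A (x + A⁻¹By) + yᵀ S y`, `S = D − BᵀA⁻¹B`, `v = (x, y)`
  (Mathlib `Matrix.schur_complement_eq₁₁`).
* **`negIndex_fromBlocks_eq` (HAYNSWORTH)**: `ν(M) = ν(A) + ν(S)`; **`posIndex_fromBlocks_eq`**: `π(M) = π(A) + π(S)`.
* `negIndex_neg_eq_posIndex` (`ν(−X) = π(X)`), `negIndex_submatrix_equiv` (inertia is invariant under
  re-indexing by an equivalence) — bookkeeping used by the companion.
PROOF: Sylvester in family language (tree `Inertia.card_le_negIndex`, `Inertia.card_add_card_le`): the negative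
eigenvectors of `A` embedded as `(a, 0)` and those of `S` embedded as `(−A⁻¹By, y)` form a negative family for `M`
of size `ν(A) + ν(S)`; the non-negative ones give an independent family of size `(p − ν(A)) + (n − ν(S))` on which
`M` is non-negative. [folklore] (Haynsworth 1968).  Axioms `propext`, `Classical.choice`, `Quot.sound`.
-/

-- layout Summits/ValiantsHypothesis/ValiantsHypothesis forces the duplicated namespace component
set_option linter.dupNamespace false

namespace Summit.ValiantsHypothesis.ValiantsHypothesis.Theorems.LacunarySymmetroidMatrixDescartes

open Matrix Finset
open scoped BigOperators

namespace GramDual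

variable {p n : Type} [Fintype p] [DecidableEq p] [Fintype n] [DecidableEq n]

/-! ## §1  The Schur-complement form identity over `ℝ` -/

omit [DecidableEq n] in
/-- **Quadratic form of a symmetric block matrix through the Schur complement** (real, `det A ≠ 0`):
`(x,y)ᵀ [[A,B],[Bᵀ,D]] (x,y) = (x + A⁻¹By)ᵀ A (x + A⁻¹By) + yᵀ (D − BᵀA⁻¹B) y`. [folklore] -/
theorem form_fromBlocks {A : Matrix p p ℝ} (hA : A.IsSymm) (hAu : IsUnit A.det) (B : Matrix p n ℝ)
    (D : Matrix n n ℝ) (x : p → ℝ) (y : n → ℝ) :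
    (Sum.elim x y) ⬝ᵥ (Matrix.fromBlocks A B Bᵀ D *ᵥ Sum.elim x y)
      = (x + (A⁻¹ * B) *ᵥ y) ⬝ᵥ (A *ᵥ (x + (A⁻¹ * B) *ᵥ y)) + y ⬝ᵥ ((D - Bᵀ * A⁻¹ * B) *ᵥ y) := by
  haveI := Matrix.invertibleOfIsUnitDet A hAu
  have hAH : A.IsHermitian := Inertia.isHermitian_of_isSymm hA
  have h := Matrix.schur_complement_eq₁₁ B D x y hAH
  simp only [Matrix.conjTranspose_eq_transpose_of_trivial, star_trivial, ← Matrix.dotProduct_mulVec] at h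
  exact h

omit [Fintype p] [DecidableEq p] [DecidableEq n] in
/-- Combination of the embedded families: `Σ c_k • fam k = (Σ c_inl a − A⁻¹B Y, Y)`, `Y = Σ c_inr y`. [folklore] -/
theorem sum_smul_embed {α β : Type} [Fintype α] [Fintype β] (G : Matrix p n ℝ) (a : α → p → ℝ) (y : β → n → ℝ)
    (c : α ⊕ β → ℝ) :
    (∑ k, c k • Sum.elim (fun i => Sum.elim (a i) (0 : n → ℝ)) (fun j => Sum.elim (-(G *ᵥ y j)) (y j)) k)
      = Sum.elim ((∑ i, c (Sum.inl i) • a i) - G *ᵥ (∑ j, c (Sum.inr j) • y j)) (∑ j, c (Sum.inr j) • y j) := by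
  funext s
  rw [Finset.sum_apply, Fintype.sum_sum_type]
  cases s with
  | inl q =>
    simp only [Sum.elim_inl, Sum.elim_inr, Pi.smul_apply, smul_eq_mul, Pi.neg_apply, Pi.add_apply,
      Finset.sum_apply, Matrix.mulVec_sum, Matrix.mulVec_smul, mul_neg, Finset.sum_neg_distrib, sub_eq_add_neg]
  | inr r =>
    simp only [Sum.elim_inl, Sum.elim_inr, Pi.smul_apply, smul_eq_mul, Pi.zero_apply, mul_zero,
      Finset.sum_const_zero, zero_add, Finset.sum_apply]

omit [DecidableEq n] in
/-- The form on a combination of the embedded families splits: `= (Σc a)ᵀA(Σc a) + YᵀSY`. [folklore] -/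
theorem form_embed {α β : Type} [Fintype α] [Fintype β] {A : Matrix p p ℝ} (hA : A.IsSymm) (hAu : IsUnit A.det)
    (B : Matrix p n ℝ) (D : Matrix n n ℝ) (a : α → p → ℝ) (y : β → n → ℝ) (c : α ⊕ β → ℝ) :
    (∑ k, c k • Sum.elim (fun i => Sum.elim (a i) (0 : n → ℝ)) (fun j => Sum.elim (-((A⁻¹ * B) *ᵥ y j)) (y j)) k)
        ⬝ᵥ (Matrix.fromBlocks A B Bᵀ D *ᵥ
          ∑ k, c k • Sum.elim (fun i => Sum.elim (a i) (0 : n → ℝ)) (fun j => Sum.elim (-((A⁻¹ * B) *ᵥ y j)) (y j)) k)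
      = (∑ i, c (Sum.inl i) • a i) ⬝ᵥ (A *ᵥ ∑ i, c (Sum.inl i) • a i)
        + (∑ j, c (Sum.inr j) • y j) ⬝ᵥ ((D - Bᵀ * A⁻¹ * B) *ᵥ ∑ j, c (Sum.inr j) • y j) := by
  rw [sum_smul_embed, form_fromBlocks hA hAu, sub_add_cancel]

/-! ## §2  Haynsworth's inertia additivity -/

/-- **HAYNSWORTH, lower bound**: `ν(A) + ν(S) ≤ ν(M)`. [folklore] -/
theorem negIndex_add_le_fromBlocks {A : Matrix p p ℝ} (hA : A.IsSymm) (hAu : IsUnit A.det) (B : Matrix p n ℝ)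
    (D : Matrix n n ℝ) (hAH : A.IsHermitian) (hS : (D - Bᵀ * A⁻¹ * B).IsHermitian)
    (hM : (Matrix.fromBlocks A B Bᵀ D).IsHermitian) :
    Fintype.card {j // hAH.eigenvalues j < 0} + Fintype.card {j // hS.eigenvalues j < 0}
      ≤ Fintype.card {j // hM.eigenvalues j < 0} := by
  classical
  have h := Inertia.card_le_negIndex hM
    (Sum.elim (fun i : {j // hAH.eigenvalues j < 0} => Sum.elim ((hAH.eigenvectorBasis i.1).ofLp) (0 : n → ℝ))
      (fun j : {j // hS.eigenvalues j < 0} =>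
        Sum.elim (-((A⁻¹ * B) *ᵥ (hS.eigenvectorBasis j.1).ofLp)) ((hS.eigenvectorBasis j.1).ofLp)))
    (fun c hc => by
      rw [form_embed hA hAu B D]
      by_cases hcl : (fun i => c (Sum.inl i)) = 0
      · have hcr : (fun j => c (Sum.inr j)) ≠ 0 := by
          intro hcr
          apply hc
          funext k
          cases k with
          | inl i => exact congrFun hcl i
          | inr j => exact congrFun hcr j
        have h1 : (∑ i, c (Sum.inl i) • (hAH.eigenvectorBasis i.1).ofLp) = 0 := by
          rw [Finset.sum_eq_zero]
          intro i _
          rw [show c (Sum.inl i) = 0 from congrFun hcl i, zero_smul]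
        rw [h1, Matrix.mulVec_zero, dotProduct_zero, zero_add]
        exact Inertia.neg_eigenFamily hS _ hcr
      · have h1 := Inertia.neg_eigenFamily hAH (fun i => c (Sum.inl i)) hcl
        by_cases hcr : (fun j => c (Sum.inr j)) = 0
        · have h2 : (∑ j, c (Sum.inr j) • (hS.eigenvectorBasis j.1).ofLp) = 0 := by
            rw [Finset.sum_eq_zero]
            intro j _
            rw [show c (Sum.inr j) = 0 from congrFun hcr j, zero_smul]
          rw [h2, Matrix.mulVec_zero, dotProduct_zero, add_zero]
          exact h1
        · exact add_neg h1 (Inertia.neg_eigenFamily hS _ hcr))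
  rwa [Fintype.card_sum] at h

/-- **HAYNSWORTH, upper bound**: `ν(M) ≤ ν(A) + ν(S)`. [folklore] -/
theorem negIndex_fromBlocks_le {A : Matrix p p ℝ} (hA : A.IsSymm) (hAu : IsUnit A.det) (B : Matrix p n ℝ)
    (D : Matrix n n ℝ) (hAH : A.IsHermitian) (hS : (D - Bᵀ * A⁻¹ * B).IsHermitian)
    (hM : (Matrix.fromBlocks A B Bᵀ D).IsHermitian) :
    Fintype.card {j // hM.eigenvalues j < 0}
      ≤ Fintype.card {j // hAH.eigenvalues j < 0} + Fintype.card {j // hS.eigenvalues j < 0} := by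
  classical
  -- the non-negative families of `A` and `S`, embedded
  set w : ({j // 0 ≤ hAH.eigenvalues j} ⊕ {j // 0 ≤ hS.eigenvalues j}) → (p ⊕ n → ℝ) :=
    Sum.elim (fun i : {j // 0 ≤ hAH.eigenvalues j} => Sum.elim ((hAH.eigenvectorBasis i.1).ofLp) (0 : n → ℝ))
      (fun j : {j // 0 ≤ hS.eigenvalues j} =>
        Sum.elim (-((A⁻¹ * B) *ᵥ (hS.eigenvectorBasis j.1).ofLp)) ((hS.eigenvectorBasis j.1).ofLp)) with hw
  have hw0 : ∀ c : ({j // 0 ≤ hAH.eigenvalues j} ⊕ {j // 0 ≤ hS.eigenvalues j}) → ℝ,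
      0 ≤ (∑ k, c k • w k) ⬝ᵥ (Matrix.fromBlocks A B Bᵀ D *ᵥ ∑ k, c k • w k) := by
    intro c
    rw [hw, form_embed hA hAu B D]
    exact add_nonneg (Inertia.nonneg_eigenFamily hAH _) (Inertia.nonneg_eigenFamily hS _)
  have hwli : LinearIndependent ℝ w := by
    rw [Fintype.linearIndependent_iff]
    intro c hc
    have hsum := hc
    rw [hw, sum_smul_embed] at hsum
    -- second components: the `S`-part vanishes
    have hY : (∑ j, c (Sum.inr j) • (hS.eigenvectorBasis j.1).ofLp) = 0 := by
      funext r
      have := congrFun hsum (Sum.inr r)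
      simpa only [Sum.elim_inr, Pi.zero_apply] using this
    have hcr : ∀ j, c (Sum.inr j) = 0 :=
      Fintype.linearIndependent_iff.1 (Inertia.linearIndependent_subtype_eigen hS fun j => 0 ≤ hS.eigenvalues j)
        (fun j => c (Sum.inr j)) hY
    have hX : (∑ i, c (Sum.inl i) • (hAH.eigenvectorBasis i.1).ofLp) = 0 := by
      funext q
      have := congrFun hsum (Sum.inl q)
      simp only [Sum.elim_inl, Pi.zero_apply, hY, Matrix.mulVec_zero, sub_zero] at this
      exact this
    have hcl : ∀ i, c (Sum.inl i) = 0 :=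
      Fintype.linearIndependent_iff.1 (Inertia.linearIndependent_subtype_eigen hAH fun j => 0 ≤ hAH.eigenvalues j)
        (fun i => c (Sum.inl i)) hX
    intro k
    cases k with
    | inl i => exact hcl i
    | inr j => exact hcr j
  have h := Inertia.card_add_card_le (Matrix.fromBlocks A B Bᵀ D) _ w (Inertia.neg_eigenFamily hM) hwli hw0
  rw [Fintype.card_sum, Inertia.card_nonneg_eigs hAH, Inertia.card_nonneg_eigs hS, Fintype.card_sum] at h
  have h1 : Fintype.card {j // hAH.eigenvalues j < 0} ≤ Fintype.card p := Fintype.card_subtype_le _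
  have h2 : Fintype.card {j // hS.eigenvalues j < 0} ≤ Fintype.card n := Fintype.card_subtype_le _
  omega

/-- **HAYNSWORTH INERTIA ADDITIVITY (negative index)**: for real symmetric `A` (`det A ≠ 0`), `D` and any `B`,
`ν([[A, B],[Bᵀ, D]]) = ν(A) + ν(D − BᵀA⁻¹B)`. [folklore] -/
theorem negIndex_fromBlocks_eq {A : Matrix p p ℝ} (hA : A.IsSymm) (hAu : IsUnit A.det) (B : Matrix p n ℝ)
    (D : Matrix n n ℝ) (hAH : A.IsHermitian) (hS : (D - Bᵀ * A⁻¹ * B).IsHermitian)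
    (hM : (Matrix.fromBlocks A B Bᵀ D).IsHermitian) :
    Fintype.card {j // hM.eigenvalues j < 0}
      = Fintype.card {j // hAH.eigenvalues j < 0} + Fintype.card {j // hS.eigenvalues j < 0} :=
  le_antisymm (negIndex_fromBlocks_le hA hAu B D hAH hS hM) (negIndex_add_le_fromBlocks hA hAu B D hAH hS hM)

/-! ## §3  Positive index and bookkeeping -/

omit [DecidableEq p] in
/-- **`ν(−X) = π(X)`.** [folklore] -/
theorem negIndex_neg_eq_posIndex [DecidableEq p] {X : Matrix p p ℝ} (hX : X.IsHermitian) (hnX : (-X).IsHermitian) :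
    Fintype.card {j // hnX.eigenvalues j < 0} = Fintype.card {j // 0 < hX.eigenvalues j} := by
  classical
  apply le_antisymm
  · refine Inertia.card_le_posIndex hX (fun i : {j // hnX.eigenvalues j < 0} => (hnX.eigenvectorBasis i.1).ofLp)
      fun c hc => ?_
    have h := Inertia.neg_eigenFamily hnX c hc
    rw [Matrix.neg_mulVec, dotProduct_neg, neg_lt_zero] at h
    exact h
  · refine Inertia.card_le_negIndex hnX (fun i : {j // 0 < hX.eigenvalues j} => (hX.eigenvectorBasis i.1).ofLp)
      fun c hc => ?_
    rw [Matrix.neg_mulVec, dotProduct_neg, neg_lt_zero]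
    exact Inertia.pos_eigenFamily hX c hc

omit [Fintype n] [DecidableEq n] in
/-- `(−A)⁻¹ = −A⁻¹` for non-degenerate `A`. [folklore] -/
theorem inv_neg_eq {A : Matrix p p ℝ} (hAu : IsUnit A.det) : (-A)⁻¹ = -A⁻¹ :=
  Matrix.inv_eq_right_inv (by rw [neg_mul_neg, Matrix.mul_nonsing_inv _ hAu])

/-- **HAYNSWORTH INERTIA ADDITIVITY (positive index)**: `π([[A, B],[Bᵀ, D]]) = π(A) + π(D − BᵀA⁻¹B)`.
[folklore] -/
theorem posIndex_fromBlocks_eq {A : Matrix p p ℝ} (hA : A.IsSymm) (hAu : IsUnit A.det) (B : Matrix p n ℝ)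
    (D : Matrix n n ℝ) (hAH : A.IsHermitian) (hS : (D - Bᵀ * A⁻¹ * B).IsHermitian)
    (hM : (Matrix.fromBlocks A B Bᵀ D).IsHermitian) :
    Fintype.card {j // 0 < hM.eigenvalues j}
      = Fintype.card {j // 0 < hAH.eigenvalues j} + Fintype.card {j // 0 < hS.eigenvalues j} := by
  classical
  -- negate everything
  have hnA : (-A).IsSymm := hA.neg
  have hnAu : IsUnit (-A).det := by
    rw [Matrix.det_neg, isUnit_iff_ne_zero]
    exact mul_ne_zero (pow_ne_zero _ (by norm_num)) hAu.ne_zero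
  have hnAH : (-A).IsHermitian := hAH.neg
  have hSn : (-D) - (-B)ᵀ * (-A)⁻¹ * (-B) = -(D - Bᵀ * A⁻¹ * B) := by
    rw [inv_neg_eq hAu, Matrix.transpose_neg]
    simp only [Matrix.neg_mul, Matrix.mul_neg, neg_neg]
    abel
  have hnS : ((-D) - (-B)ᵀ * (-A)⁻¹ * (-B)).IsHermitian := by rw [hSn]; exact hS.neg
  have hMn : Matrix.fromBlocks (-A) (-B) (-B)ᵀ (-D) = -Matrix.fromBlocks A B Bᵀ D := by
    rw [Matrix.transpose_neg, ← Matrix.fromBlocks_neg]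
  have hnM : (Matrix.fromBlocks (-A) (-B) (-B)ᵀ (-D)).IsHermitian := by rw [hMn]; exact hM.neg
  have h := negIndex_fromBlocks_eq hnA hnAu (-B) (-D) hnAH hnS hnM
  have e1 : Fintype.card {j // hnM.eigenvalues j < 0} = Fintype.card {j // 0 < hM.eigenvalues j} := by
    have hnM' : (-Matrix.fromBlocks A B Bᵀ D).IsHermitian := hM.neg
    rw [Inertia.negIndex_congr hnM hnM' hMn]
    exact negIndex_neg_eq_posIndex hM hnM'
  have e2 : Fintype.card {j // hnAH.eigenvalues j < 0} = Fintype.card {j // 0 < hAH.eigenvalues j} :=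
    negIndex_neg_eq_posIndex hAH hnAH
  have e3 : Fintype.card {j // hnS.eigenvalues j < 0} = Fintype.card {j // 0 < hS.eigenvalues j} := by
    have hnS' : (-(D - Bᵀ * A⁻¹ * B)).IsHermitian := hS.neg
    rw [Inertia.negIndex_congr hnS hnS' hSn]
    exact negIndex_neg_eq_posIndex hS hnS'
  rw [← e1, ← e2, ← e3]
  exact h

end GramDual

end Summit.ValiantsHypothesis.ValiantsHypothesis.Theorems.LacunarySymmetroidMatrixDescartes
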